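import Summits.BirchSwinnertonDyer.Rank1Residual.Additive.X3LineDatumOfKernelPolyCert
import Summits.BirchSwinnertonDyer.Rank1Residual.Additive.RationalLineTwistRamifiedOfShiftedKernelPolynomial
import HarnessLib

/-!
# `CaseOneDatum W p` at `p ≥ 5` from a kernel-polynomial certificate with a SHIFT — the per-prime
# wrappers used by the records files (cell `bsd-addord`, seat `bsd-addord-twist`; the Φ₀ kernel-records
# programme, sequel of `X3LineDatumOfKernelPolyCert.lean`)

HONEST FRAMING (cell `bsd-addord`, `run/shared/lean/pub/bsd-addord/README.md` §4): the programme's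
target of record is the full Birch–Swinnerton-Dyer formula for every `E/ℚ` of analytic rank `≤ 1`;
this is a TOOL file (theorems only, no definition, no named fact, no `sorry`). It books nothing; the
class binders stay data of record as in the booking doors.

## What

`X3LineDatumOfKernelPolyCert.lean` assembles `CaseOneDatum W p` from (c1) `preΨ'_p = h·q`, (c2) the
doubling closure, (c3) `±2` generates, (B) the trace certificate and (C) the valuation certificate on
`h` itself. On a general globally minimal member the valuation certificate holds for the TRANSLATE
`g = h(X + s)`, `s ≡` the abscissa of the singular point of `W mod p` (file
`RationalLineTwistRamifiedOfShiftedKernelPolynomial.lean`). This file gives the shifted assembly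
**`ClassX3Gord.caseOneDatum_of_shiftedKernelPolyCert`** and the wrappers
**`caseOneDatum_five_of_shiftedCert`** (`h = X² + c₁X + c₀`: `5 ∣ c₁ + 2s`,
`c₀ + c₁s + s² = 5a`, `5 ∤ a`) and **`caseOneDatum_seven_of_shiftedCert`** (`h = X³ + c₂X² + c₁X + c₀`:
`7 ∣ c₂ + 3s`, `7² ∣ c₁ + 2c₂s + 3s²`, `c₀ + c₁s + c₂s² + s³ = 7²a`, `7 ∤ a`), the other inputs as in
the unshifted wrappers. Consumers: `X3LineDatum{Five,Seven}Records*.lean`.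

References: R. Greenberg, V. Vatsal, Invent. Math. 142 (2000) §2 p. 28 [GreenbergVatsal2000];
J. H. Silverman, *AEC* 2nd ed., Exercise 3.7, VII.2.1 [SilvermanAEC2009]; HOME/proof/phi0-p5/README.md.
-/

set_option autoImplicit false

noncomputable section

open scoped Classical NumberField

open WeierstrassCurve Polynomial Literature.NumberTheory.EllipticCurves
  Literature.NumberTheory.EllipticCurves.Rank1Residual Literature.NumberTheory.GaloisRepresentations
  Field IsDedekindDomain NumberField
  Summit.BirchSwinnertonDyer.Rank1Residual.Additive.KernelPolyLineRecords

namespace Summit.BirchSwinnertonDyer.Rank1Residual.Additive.KernelPolyLine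

variable {W : WeierstrassCurve ℚ} [W.IsElliptic] [W.IsGloballyMinimal] {p : ℕ} [hp : Fact p.Prime]

/-- **`CaseOneDatum` at `p ≥ 5` from a kernel-polynomial certificate with shift `s`** (keystone +
trace certificate + shifted valuation certificate). [cite: GreenbergVatsal2000, §2 p. 28]
[cite: SilvermanAEC2009, Exercise 3.7] -/
theorem ClassX3Gord.caseOneDatum_of_shiftedKernelPolyCert (hX : ClassX3Gord W p) (hp5 : 5 ≤ p)
    (he : semistabilityIndex W p = 2) {h q q₂ : ℚ[X]} {m : ℕ} (hm : 2 * m + 1 = p)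
    (hmon : h.Monic) (hdegm : h.natDegree = m) (hdiv : W.preΨ' p = h * q)
    (hdbl : ∑ i ∈ Finset.range (m + 1), C (h.coeff i) * W.Φ 2 ^ i * W.Ψ₂Sq ^ (m - i) = h * q₂)
    (hgen : ∀ k : ZMod p, k ≠ 0 → ∃ (s : ℤˣ) (j : ℕ), k = ((s : ℤ) * 2 ^ j : ℤ))
    {E₁ E₂ E₃ : ℚ} (hE₁ : h.coeff (m - 1) = -E₁) (hE₂ : h.coeff (m - 2) = E₂)
    (hE₃ : (3 ≤ m ∧ h.coeff (m - 3) = -E₃) ∨ (m = 2 ∧ E₃ = 0))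
    (hT : 0 < 4 * (E₁ ^ 3 - 3 * E₁ * E₂ + 3 * E₃) + W.b₂ * (E₁ ^ 2 - 2 * E₂) + 2 * W.b₄ * E₁ + m * W.b₆)
    (s : ℤ)
    (hcoef : ∀ k, 0 < k → k < m → ∃ c : ℤ, (h.comp (X + C (s : ℚ))).coeff k = (c : ℚ) ∧ (p : ℤ) ^ (m - k) ∣ c)
    (hzero : ∃ a : ℤ, (h.comp (X + C (s : ℚ))).coeff 0 = (p : ℚ) ^ (m - 1) * a ∧ ¬ (p : ℤ) ∣ a) :
    CaseOneDatum W p := by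
  have hp2 : p ≠ 2 := by omega
  have hne : h ≠ 0 := hmon.ne_zero
  have hd : (h.map (algebraMap ℚ (AlgebraicClosure ℚ))).degree ≠ 0 := by
    rw [degree_map, degree_eq_natDegree hne, hdegm]
    exact_mod_cast (show m ≠ 0 by omega)
  obtain ⟨α, hα⟩ := IsAlgClosed.exists_root _ hd
  obtain ⟨Φ₀, hΦ, habs⟩ := exists_isRationalLine_of_kernelPolyCert hp2 hm hdegm.le hdiv hdbl hgen ⟨α, hα⟩
  have heven : LineEven W p Φ₀ :=
    lineEven_of_traceCert_pos hp2 hm hmon hdegm hdiv hΦ habs hE₁ hE₂ hE₃ hT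
  have hram := ClassX3Gord.hram_of_shiftedKernelPolyCert hX hp5 he hm hmon hdegm s hcoef hzero hΦ habs
  exact caseOneDatum_of_isRationalLine_of_lineEven hX hp5 he Φ₀ hΦ heven hram

/-- **`p = 5` with shift** (`h = X² + c₁X + c₀`, `g = h(X + s) = X² + (c₁ + 2s)X + (c₀ + c₁s + s²)`).
[cite: GreenbergVatsal2000, §2 p. 28] -/
theorem caseOneDatum_five_of_shiftedCert [Fact (Nat.Prime 5)] (hX : ClassX3Gord W 5)
    (he : semistabilityIndex W 5 = 2) (c₁ c₀ s a : ℤ) (q q₂ : ℚ[X])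
    (hdiv : W.preΨ' 5 = (X ^ 2 + C (c₁ : ℚ) * X + C (c₀ : ℚ)) * q)
    (hdbl : C (c₀ : ℚ) * W.Ψ₂Sq ^ 2 + C (c₁ : ℚ) * W.Φ 2 * W.Ψ₂Sq + W.Φ 2 ^ 2 =
      (X ^ 2 + C (c₁ : ℚ) * X + C (c₀ : ℚ)) * q₂)
    (hT : 0 < 4 * ((-(c₁ : ℚ)) ^ 3 - 3 * (-(c₁ : ℚ)) * c₀ + 3 * 0) + W.b₂ * ((-(c₁ : ℚ)) ^ 2 - 2 * c₀) +
      2 * W.b₄ * (-(c₁ : ℚ)) + (2 : ℕ) * W.b₆)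
    (hg₁ : (5 : ℤ) ∣ c₁ + 2 * s) (hg₀ : c₀ + c₁ * s + s ^ 2 = 5 * a) (ha : ¬ (5 : ℤ) ∣ a) :
    CaseOneDatum W 5 := by
  set h : ℚ[X] := X ^ 2 + C (c₁ : ℚ) * X + C (c₀ : ℚ) with hh
  have hmon : h.Monic := by rw [hh]; monicity!
  have hdegm : h.natDegree = 2 := by rw [hh]; compute_degree!
  have hc0 : h.coeff 0 = c₀ := by
    rw [hh]; simp only [coeff_add, coeff_C_mul, coeff_X_pow, coeff_X, coeff_C]; norm_num
  have hc1 : h.coeff 1 = c₁ := by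
    rw [hh]; simp only [coeff_add, coeff_C_mul, coeff_X_pow, coeff_X, coeff_C]; norm_num
  have hc2 : h.coeff 2 = 1 := by
    rw [hh]; simp only [coeff_add, coeff_C_mul, coeff_X_pow, coeff_X, coeff_C]; norm_num
  -- the shifted polynomial
  have hg : h.comp (X + C (s : ℚ)) =
      X ^ 2 + C ((c₁ + 2 * s : ℤ) : ℚ) * X + C ((c₀ + c₁ * s + s ^ 2 : ℤ) : ℚ) := by
    rw [hh]
    simp only [add_comp, mul_comp, X_pow_comp, X_comp, C_comp]
    push_cast
    simp only [map_add, map_mul, map_pow, map_intCast, map_ofNat]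
    ring
  have hg0 : (h.comp (X + C (s : ℚ))).coeff 0 = ((c₀ + c₁ * s + s ^ 2 : ℤ) : ℚ) := by
    rw [hg]; simp only [coeff_add, coeff_C_mul, coeff_X_pow, coeff_X, coeff_C]; norm_num
  have hg1 : (h.comp (X + C (s : ℚ))).coeff 1 = ((c₁ + 2 * s : ℤ) : ℚ) := by
    rw [hg]; simp only [coeff_add, coeff_C_mul, coeff_X_pow, coeff_X, coeff_C]; norm_num
  refine ClassX3Gord.caseOneDatum_of_shiftedKernelPolyCert hX (le_refl 5) he (m := 2) rfl hmon hdegm hdiv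
    (q₂ := q₂) ?_ gen_five (E₁ := -(c₁ : ℚ)) (E₂ := (c₀ : ℚ)) (E₃ := 0) (by rw [hc1, neg_neg])
    (by rw [hc0]) (Or.inr ⟨rfl, rfl⟩) hT s ?_ ?_
  · simp only [Finset.sum_range_succ, Finset.sum_range_zero, zero_add, hc0, hc1, hc2, pow_zero, pow_one,
      Nat.sub_zero, Nat.sub_self, show 2 - 1 = 1 from rfl, mul_one, one_mul, map_one]
    rw [← hdbl]
  · intro k hk0 hk2
    obtain rfl : k = 1 := by omega
    exact ⟨c₁ + 2 * s, hg1, by rw [pow_one]; exact hg₁⟩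
  · exact ⟨a, by rw [hg0, hg₀]; push_cast; ring, ha⟩

/-- **`p = 7` with shift** (`h = X³ + c₂X² + c₁X + c₀`,
`g = h(X + s) = X³ + (c₂ + 3s)X² + (c₁ + 2c₂s + 3s²)X + (c₀ + c₁s + c₂s² + s³)`).
[cite: GreenbergVatsal2000, §2 p. 28] -/
theorem caseOneDatum_seven_of_shiftedCert [Fact (Nat.Prime 7)] (hX : ClassX3Gord W 7)
    (he : semistabilityIndex W 7 = 2) (c₂ c₁ c₀ s a : ℤ) (q q₂ : ℚ[X])
    (hdiv : W.preΨ' 7 = (X ^ 3 + C (c₂ : ℚ) * X ^ 2 + C (c₁ : ℚ) * X + C (c₀ : ℚ)) * q)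
    (hdbl : C (c₀ : ℚ) * W.Ψ₂Sq ^ 3 + C (c₁ : ℚ) * W.Φ 2 * W.Ψ₂Sq ^ 2 + C (c₂ : ℚ) * W.Φ 2 ^ 2 * W.Ψ₂Sq +
      W.Φ 2 ^ 3 = (X ^ 3 + C (c₂ : ℚ) * X ^ 2 + C (c₁ : ℚ) * X + C (c₀ : ℚ)) * q₂)
    (hT : 0 < 4 * ((-(c₂ : ℚ)) ^ 3 - 3 * (-(c₂ : ℚ)) * c₁ + 3 * (-(c₀ : ℚ))) +
      W.b₂ * ((-(c₂ : ℚ)) ^ 2 - 2 * c₁) + 2 * W.b₄ * (-(c₂ : ℚ)) + (3 : ℕ) * W.b₆)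
    (hg₂ : (7 : ℤ) ∣ c₂ + 3 * s) (hg₁ : (7 : ℤ) ^ 2 ∣ c₁ + 2 * c₂ * s + 3 * s ^ 2)
    (hg₀ : c₀ + c₁ * s + c₂ * s ^ 2 + s ^ 3 = 7 ^ 2 * a) (ha : ¬ (7 : ℤ) ∣ a) :
    CaseOneDatum W 7 := by
  set h : ℚ[X] := X ^ 3 + C (c₂ : ℚ) * X ^ 2 + C (c₁ : ℚ) * X + C (c₀ : ℚ) with hh
  have hmon : h.Monic := by rw [hh]; monicity!
  have hdegm : h.natDegree = 3 := by rw [hh]; compute_degree!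
  have hc0 : h.coeff 0 = c₀ := by
    rw [hh]; simp only [coeff_add, coeff_C_mul, coeff_X_pow, coeff_X, coeff_C]; norm_num
  have hc1 : h.coeff 1 = c₁ := by
    rw [hh]; simp only [coeff_add, coeff_C_mul, coeff_X_pow, coeff_X, coeff_C]; norm_num
  have hc2 : h.coeff 2 = c₂ := by
    rw [hh]; simp only [coeff_add, coeff_C_mul, coeff_X_pow, coeff_X, coeff_C]; norm_num
  have hc3 : h.coeff 3 = 1 := by
    rw [hh]; simp only [coeff_add, coeff_C_mul, coeff_X_pow, coeff_X, coeff_C]; norm_num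
  have hg : h.comp (X + C (s : ℚ)) =
      X ^ 3 + C ((c₂ + 3 * s : ℤ) : ℚ) * X ^ 2 + C ((c₁ + 2 * c₂ * s + 3 * s ^ 2 : ℤ) : ℚ) * X +
        C ((c₀ + c₁ * s + c₂ * s ^ 2 + s ^ 3 : ℤ) : ℚ) := by
    rw [hh]
    simp only [add_comp, mul_comp, X_pow_comp, X_comp, C_comp]
    push_cast
    simp only [map_add, map_mul, map_pow, map_intCast, map_ofNat]
    ring
  have hg0 : (h.comp (X + C (s : ℚ))).coeff 0 = ((c₀ + c₁ * s + c₂ * s ^ 2 + s ^ 3 : ℤ) : ℚ) := by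
    rw [hg]; simp only [coeff_add, coeff_C_mul, coeff_X_pow, coeff_X, coeff_C]; norm_num
  have hg1 : (h.comp (X + C (s : ℚ))).coeff 1 = ((c₁ + 2 * c₂ * s + 3 * s ^ 2 : ℤ) : ℚ) := by
    rw [hg]; simp only [coeff_add, coeff_C_mul, coeff_X_pow, coeff_X, coeff_C]; norm_num
  have hg2 : (h.comp (X + C (s : ℚ))).coeff 2 = ((c₂ + 3 * s : ℤ) : ℚ) := by
    rw [hg]; simp only [coeff_add, coeff_C_mul, coeff_X_pow, coeff_X, coeff_C]; norm_num
  refine ClassX3Gord.caseOneDatum_of_shiftedKernelPolyCert hX (by norm_num) he (m := 3) rfl hmon hdegm hdiv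
    (q₂ := q₂) ?_ gen_seven (E₁ := -(c₂ : ℚ)) (E₂ := (c₁ : ℚ)) (E₃ := -(c₀ : ℚ)) (by rw [hc2, neg_neg])
    (by rw [hc1]) (Or.inl ⟨le_refl 3, by rw [hc0, neg_neg]⟩) hT s ?_ ?_
  · simp only [Finset.sum_range_succ, Finset.sum_range_zero, zero_add, hc0, hc1, hc2, hc3, pow_zero,
      pow_one, Nat.sub_zero, Nat.sub_self, show 3 - 1 = 2 from rfl, show 3 - 2 = 1 from rfl, mul_one,
      one_mul, map_one]
    rw [← hdbl]
  · intro k hk0 hk3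
    interval_cases k
    · exact ⟨_, hg1, hg₁⟩
    · exact ⟨_, hg2, by rw [pow_one]; exact hg₂⟩
  · exact ⟨a, by rw [hg0, hg₀]; push_cast; ring, ha⟩

end Summit.BirchSwinnertonDyer.Rank1Residual.Additive.KernelPolyLine

end
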